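import Literature.AlgebraicGeometry.Resolution.AlterationsSemiStableCodimTwoBlowupFlat
import Literature.AlgebraicGeometry.Resolution.StalkIdealLemmas
import HarnessLib

/-!
# `WildQuotients.SummitReduction` (stmt-ResolutionOfSingularities-16324), line `FramePerfect`:
# algebra for stub C1 (`stub_pair_orbitBlowupCentreFlat`) — intersections of the ideals `(u, v, a)`
# of the model ring `Λ⟦u, v⟧/(uv - h)`

Route `ResolutionOfSingularities/WildQuotients`, crux `SummitReduction`; helper file of the line
skeleton (v8), stub C1 = de Jong 1996, 3.4 Claim (ii) over the centre `Z = cl(G · x)` of the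
blow-up of the ORBIT closure of a codimension-2 singular point (de Jong 1997, proof of 5.11 ¶1).
At a closed point `z ∈ Z` several translates `cl{x_g}` may pass; in the formal model
`𝒪̂_{X,z} ≅ Λ⟦u, v⟧/(uv - ∏ Tᵢ^{νᵢ})`, `Λ = κ⟦T₁, …, T_m⟧` (2.23 + 3.3), each has completed ideal
`(u, v, T_i)` for an index with `νᵢ ≥ 2` (3.4 ¶2), so the completed ideal of `Z` is the
INTERSECTION `⋂_{i ∈ S} (u, v, Tᵢ) = (u, v, ∏_{i ∈ S} Tᵢ)`, again of the shape `(u, v, t)` with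
`uv = c · t²` — which is all that the flatness and connectedness arguments of p. 64 use. This file
is the pure algebra of that remark:

* `centreFlat_span_triple_eq_comap_constantCoeff` — `(u, v, a) ⊆ Λ⟦u, v⟧` is the preimage of
  `(a) ⊆ Λ` under the constant coefficient;
* `centreFlat_comap_mk_span_triple` — for `a ∣ h`, the preimage of `(u, v, a) ⊆ Λ⟦u, v⟧/(uv - h)`
  in `Λ⟦u, v⟧` is `(u, v, a)`;
* `centreFlat_iInf_span_triple` — hence `⋂ᵢ (u, v, aᵢ) = (u, v, ∏ aᵢ)` in `Λ⟦u, v⟧/(uv - h)`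
  whenever `⋂ᵢ (aᵢ) = (∏ aᵢ)` in `Λ` and `∏ aᵢ ∣ h`;
* `centreFlat_iInf_span_X` — `⋂_{i ∈ S} (Tᵢ) = (∏_{i ∈ S} Tᵢ)` in `κ⟦T₁, …, T_m⟧`;
* `centreFlat_prod_pow_eq_mul_sq` — `∏ Tᵢ^{νᵢ} = c · (∏_{i ∈ S} Tᵢ)²` for `νᵢ ≥ 2` on `S`;
* `centreFlat_iInf_span_triple_X` — the combination in `κ⟦T⟧⟦u, v⟧/(uv - ∏ Tᵢ^{νᵢ})`.
-/

-- the problem path `ResolutionOfSingularities/ResolutionOfSingularities` makes the conventional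
-- namespace repeat a component, which `linter.dupNamespace` flags
set_option linter.dupNamespace false

noncomputable section

open Literature.AlgebraicGeometry.Resolution
open Literature.AlgebraicGeometry.Resolution.DeJong1996

namespace Summit.ResolutionOfSingularities.ResolutionOfSingularities.Theorems

universe u

/-! ## `(u, v, a)` in `Λ⟦u, v⟧` -/

/-- In `Λ⟦u, v⟧` the ideal `(u, v, a)` is the preimage of `(a) ⊆ Λ` under the constant
coefficient `Λ⟦u, v⟧ → Λ` (a power series without constant term lies in `(u, v)`). [folklore] -/
theorem centreFlat_span_triple_eq_comap_constantCoeff {Λ : Type u} [CommRing Λ] (a : Λ) :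
    (Ideal.span {(MvPowerSeries.X 0 : MvPowerSeries (Fin 2) Λ), MvPowerSeries.X 1,
        MvPowerSeries.C a} : Ideal (MvPowerSeries (Fin 2) Λ)) =
      (Ideal.span {a}).comap (MvPowerSeries.constantCoeff : MvPowerSeries (Fin 2) Λ →+* Λ) := by
  apply le_antisymm
  · rw [Ideal.span_le]
    rintro p hp
    simp only [Set.mem_insert_iff, Set.mem_singleton_iff] at hp
    rcases hp with rfl | rfl | rfl
    · simp
    · simp
    · simp
  · intro p hp
    rw [Ideal.mem_comap, Ideal.mem_span_singleton'] at hp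
    obtain ⟨b, hb⟩ := hp
    have h1 : p - MvPowerSeries.C (b * a) ∈
        Ideal.span {(MvPowerSeries.X 0 : MvPowerSeries (Fin 2) Λ), MvPowerSeries.X 1} :=
      MvPowerSeries.mem_span_X_pair_of_constantCoeff_eq_zero
        (by rw [map_sub, MvPowerSeries.constantCoeff_C, hb, sub_self])
    have h2 : Ideal.span {(MvPowerSeries.X 0 : MvPowerSeries (Fin 2) Λ), MvPowerSeries.X 1} ≤
        Ideal.span {(MvPowerSeries.X 0 : MvPowerSeries (Fin 2) Λ), MvPowerSeries.X 1,
          MvPowerSeries.C a} :=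
      Ideal.span_mono fun x hx => by
        simp only [Set.mem_insert_iff, Set.mem_singleton_iff] at hx ⊢
        tauto
    have h3 : MvPowerSeries.C (b * a) ∈
        Ideal.span {(MvPowerSeries.X 0 : MvPowerSeries (Fin 2) Λ), MvPowerSeries.X 1,
          MvPowerSeries.C a} := by
      rw [map_mul]
      exact Ideal.mul_mem_left _ _ (Ideal.subset_span (by simp))
    have h4 := Ideal.add_mem _ (h2 h1) h3
    rwa [sub_add_cancel] at h4

/-! ## `(u, v, a)` in `Λ⟦u, v⟧/(uv - h)` -/

/-- For `a ∣ h`, the preimage in `Λ⟦u, v⟧` of the ideal `(u, v, a)` of `Λ⟦u, v⟧/(uv - h)` is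
`(u, v, a)` (it contains the relation `uv - h`). [folklore] -/
theorem centreFlat_comap_mk_span_triple {Λ : Type u} [CommRing Λ] {h a : Λ} (ha : a ∣ h) :
    (Ideal.span {Ideal.Quotient.mk _ (MvPowerSeries.X 0), Ideal.Quotient.mk _ (MvPowerSeries.X 1),
        Ideal.Quotient.mk _ (MvPowerSeries.C a)} : Ideal (NodeDeformationRing Λ h)).comap
        (Ideal.Quotient.mk (Ideal.span {nodeDeformationRelation Λ h})) =
      Ideal.span {(MvPowerSeries.X 0 : MvPowerSeries (Fin 2) Λ), MvPowerSeries.X 1,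
        MvPowerSeries.C a} := by
  have hmap : (Ideal.span {(MvPowerSeries.X 0 : MvPowerSeries (Fin 2) Λ), MvPowerSeries.X 1,
      MvPowerSeries.C a}).map (Ideal.Quotient.mk (Ideal.span {nodeDeformationRelation Λ h})) =
      Ideal.span {Ideal.Quotient.mk _ (MvPowerSeries.X 0), Ideal.Quotient.mk _ (MvPowerSeries.X 1),
        Ideal.Quotient.mk _ (MvPowerSeries.C a)} := by
    rw [Ideal.map_span, Set.image_insert_eq, Set.image_insert_eq, Set.image_singleton]
  rw [← hmap, Ideal.comap_map_of_surjective _ Ideal.Quotient.mk_surjective,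
    ← RingHom.ker_eq_comap_bot, Ideal.mk_ker, sup_eq_left, Ideal.span_singleton_le_iff_mem]
  obtain ⟨b, hb⟩ := ha
  rw [nodeDeformationRelation, hb, map_mul]
  exact Ideal.sub_mem _ (Ideal.mul_mem_right _ _ (Ideal.subset_span (by simp)))
    (Ideal.mul_mem_right _ _ (Ideal.subset_span (by simp)))

/-- **`⋂ᵢ (u, v, aᵢ) = (u, v, ∏ aᵢ)` in `Λ⟦u, v⟧/(uv - h)`**, for finitely many divisors `aᵢ` of
`h` with `⋂ᵢ (aᵢ) = (∏ aᵢ)` in `Λ` and `∏ aᵢ ∣ h`: pull back to `Λ⟦u, v⟧`, where both sides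
are preimages under the constant coefficient. [folklore] -/
theorem centreFlat_iInf_span_triple {Λ : Type u} [CommRing Λ] {h : Λ} {ι : Type*} (s : Finset ι)
    (a : ι → Λ) (ha : ∀ i ∈ s, a i ∣ h) (hprod : (∏ i ∈ s, a i) ∣ h)
    (hinf : ⨅ i ∈ s, Ideal.span {a i} = Ideal.span {∏ i ∈ s, a i}) :
    ⨅ i ∈ s, (Ideal.span {Ideal.Quotient.mk _ (MvPowerSeries.X 0),
        Ideal.Quotient.mk _ (MvPowerSeries.X 1), Ideal.Quotient.mk _ (MvPowerSeries.C (a i))} :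
        Ideal (NodeDeformationRing Λ h)) =
      Ideal.span {Ideal.Quotient.mk _ (MvPowerSeries.X 0), Ideal.Quotient.mk _ (MvPowerSeries.X 1),
        Ideal.Quotient.mk _ (MvPowerSeries.C (∏ i ∈ s, a i))} := by
  apply Ideal.comap_injective_of_surjective
    (Ideal.Quotient.mk (Ideal.span {nodeDeformationRelation Λ h})) Ideal.Quotient.mk_surjective
  simp only [Ideal.comap_iInf]
  rw [centreFlat_comap_mk_span_triple hprod, centreFlat_span_triple_eq_comap_constantCoeff, ← hinf]
  simp only [Ideal.comap_iInf]
  refine iInf_congr fun i => iInf_congr fun hi => ?_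
  rw [centreFlat_comap_mk_span_triple (ha i hi), centreFlat_span_triple_eq_comap_constantCoeff]

/-! ## Distinct variables of `κ⟦T₁, …, T_m⟧` -/

/-- Distinct variables of a power series ring over a field do not divide one another. [folklore] -/
theorem centreFlat_not_X_dvd_X {κ : Type u} [Field κ] {m : ℕ} {i j : Fin m} (hij : i ≠ j) :
    ¬ (MvPowerSeries.X i : MvPowerSeries (Fin m) κ) ∣ MvPowerSeries.X j := by
  classical
  intro hdvd
  rw [MvPowerSeries.X_dvd_iff] at hdvd
  have h1 := hdvd (Finsupp.single j 1) (by rw [Finsupp.single_apply, if_neg hij.symm])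
  rw [MvPowerSeries.coeff_X, if_pos rfl] at h1
  exact one_ne_zero h1

/-- **`⋂_{i ∈ S} (Tᵢ) = (∏_{i ∈ S} Tᵢ)` in `κ⟦T₁, …, T_m⟧`**: the variables are pairwise
non-associated primes. [folklore] -/
theorem centreFlat_iInf_span_X {κ : Type u} [Field κ] {m : ℕ} (s : Finset (Fin m)) :
    ⨅ i ∈ s, Ideal.span {(MvPowerSeries.X i : MvPowerSeries (Fin m) κ)} =
      Ideal.span {∏ i ∈ s, MvPowerSeries.X i} := by
  classical
  apply le_antisymm
  · intro f hf
    rw [Ideal.mem_span_singleton]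
    refine Finset.prod_dvd_of_forall_dvd_of_pairwise
      (fun i => (MvPowerSeries.X i : MvPowerSeries (Fin m) κ)) s
      (fun i _ => MvPowerSeries.prime_X' κ i) (fun i _ j _ hij => centreFlat_not_X_dvd_X hij)
      (fun i hi => ?_)
    have h1 := (Submodule.mem_iInf _).mp hf i
    have h2 := (Submodule.mem_iInf _).mp h1 hi
    exact Ideal.mem_span_singleton.mp h2
  · refine le_iInf₂ fun i hi => ?_
    rw [Ideal.span_singleton_le_span_singleton]
    exact Finset.dvd_prod_of_mem _ hi

/-! ## The exponent bookkeeping `∏ Tᵢ^{νᵢ} = c · t²` -/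

/-- `∏ᵢ xᵢ^{νᵢ} = (∏ᵢ xᵢ^{μᵢ}) · (∏_{i ∈ S} xᵢ)²` with `μᵢ = νᵢ - 2` on `S` (where `νᵢ ≥ 2`) and
`μᵢ = νᵢ` off `S`. [folklore] -/
theorem centreFlat_prod_pow_eq_mul_sq {M : Type*} [CommMonoid M] {m : ℕ} (x : Fin m → M)
    (ν : Fin m → ℕ) (s : Finset (Fin m)) (hν : ∀ i ∈ s, 2 ≤ ν i) :
    ∏ i, x i ^ ν i = (∏ i, x i ^ (if i ∈ s then ν i - 2 else ν i)) * (∏ i ∈ s, x i) ^ 2 := by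
  classical
  have h1 : (∏ i ∈ s, x i) ^ 2 = ∏ i, x i ^ (if i ∈ s then 2 else 0) := by
    rw [← Finset.prod_pow, ← Finset.prod_filter_mul_prod_filter_not Finset.univ (· ∈ s)]
    have h2 : ∏ i ∈ Finset.univ.filter (fun i => i ∉ s), x i ^ (if i ∈ s then 2 else 0) = 1 :=
      Finset.prod_eq_one fun i hi => by
        rw [Finset.mem_filter] at hi
        rw [if_neg hi.2, pow_zero]
    rw [h2, mul_one, Finset.filter_mem_eq_inter, Finset.univ_inter]
    exact Finset.prod_congr rfl fun i hi => by rw [if_pos hi]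
  rw [h1, ← Finset.prod_mul_distrib]
  refine Finset.prod_congr rfl fun i _ => ?_
  rw [← pow_add]
  congr 1
  split_ifs with hi
  · have := hν i hi
    omega
  · rfl

/-! ## The combination in `κ⟦T⟧⟦u, v⟧/(uv - ∏ Tᵢ^{νᵢ})` -/

/-- **`⋂_{i ∈ S} (u, v, Tᵢ) = (u, v, ∏_{i ∈ S} Tᵢ)` in `Λ⟦u, v⟧/(uv - ∏ Tᵢ^{νᵢ})`,
`Λ = κ⟦T₁, …, T_m⟧`, for a set `S` of indices with `νᵢ ≥ 2`** — the completed ideal, at a closed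
point through which several codimension-2 singular components pass, of their union (each being
`(u, v, Tᵢ)` by de Jong 1996, 3.4 ¶2). [cite: DeJong1996, 3.4, p. 63] -/
theorem centreFlat_iInf_span_triple_X {κ : Type u} [Field κ] {m : ℕ} (ν : Fin m → ℕ)
    (s : Finset (Fin m)) (hν : ∀ i ∈ s, 2 ≤ ν i) :
    ⨅ i ∈ s, (Ideal.span {Ideal.Quotient.mk _ (MvPowerSeries.X 0),
        Ideal.Quotient.mk _ (MvPowerSeries.X 1),
        Ideal.Quotient.mk _ (MvPowerSeries.C (MvPowerSeries.X i))} :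
        Ideal (NodeDeformationRing (MvPowerSeries (Fin m) κ) (∏ i, MvPowerSeries.X i ^ ν i))) =
      Ideal.span {Ideal.Quotient.mk _ (MvPowerSeries.X 0), Ideal.Quotient.mk _ (MvPowerSeries.X 1),
        Ideal.Quotient.mk _ (MvPowerSeries.C (∏ i ∈ s, MvPowerSeries.X i))} := by
  classical
  refine centreFlat_iInf_span_triple s (fun i => (MvPowerSeries.X i : MvPowerSeries (Fin m) κ))
    (fun i hi => ?_) ?_ (centreFlat_iInf_span_X s)
  · have h0 : ν i ≠ 0 := by have := hν i hi; omega
    exact (dvd_pow_self (MvPowerSeries.X i) h0).trans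
      (Finset.dvd_prod_of_mem (fun i => (MvPowerSeries.X i : MvPowerSeries (Fin m) κ) ^ ν i)
        (Finset.mem_univ i))
  · rw [centreFlat_prod_pow_eq_mul_sq MvPowerSeries.X ν s hν, sq]
    exact dvd_mul_of_dvd_right (dvd_mul_right _ _) _

end Summit.ResolutionOfSingularities.ResolutionOfSingularities.Theorems

end
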